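import Literature.MathematicalPhysics.KineticTheory.ConfinedLocalMinorization
import HarnessLib

/-!
# Additive-noise SDEs with a confined drift: the local small set at a controllable equilibrium, uniformly in the noise amplitudes

Trunk T-KINETIC (Literature/MathematicalPhysics/KineticTheory). MODEL-FREE version of the
uniform-in-the-bath-temperatures local minorisation proved for the pinned chain in the Summits tree
(`…OddSectorIrreversibilityCorrectorTheoryUniformMinorization.lean`). `ConfinedLocalMinorization.lean`
(`ConfinedDrift.minorization_at_one`) minorises the transition probabilities
`P_1(z, ·) = law Φ_1(z, B)` of `dz = Y(z) dt + v₁ dB¹ + v₂ dB²` near an equilibrium `x₀` of the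
confined drift `Y` at which `(DY(x₀), v₁)` satisfies Kalman's condition, for FIXED noise vectors.
Here ONE triple of constants serves all noise vectors `(l₁ v₁, l₂ v₂)` whose amplitude ratios
`(l₁, l₂)` to the reference vectors are close to `1`: in the finite-dimensional submersion argument
the ratios enter only through the diagonal RESCALING `x ↦ (l₁ x¹, l₂ x²)` of the dyadic skeleton
(`skelNoisePath_smul`), which joins the initial condition and the remainder noise in the parameter
of the locally uniform submersion estimate `exists_measure_preimage_ge_of_surjective`.

* `skelNoisePath_smul` — `n^{v₁,v₂}_{(l₁x¹, l₂x²), ρ} = n^{l₁v₁, l₂v₂}_{x, ρ}`;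
* `ConfinedDrift.minorization_at_one_uniform` — there are `ε₁, r > 0` and `c > 0` with
  `P^{l₁v₁, l₂v₂}_1(z, T) ≥ c · Λ(T)` for all measurable `T ⊆ B(x₀, r)`, all `z ∈ B(x₀, ε₁)` and
  all `|l₁ - 1| < ε₁`, `|l₂ - 1| < ε₁` (`Λ` any additive Haar measure on the state space);
* `ConfinedDrift.exists_smul_restrict_le_sdeKernel_one_uniform` — the same in measure form.

## References

* N. Cuneo, J.-P. Eckmann, M. Hairer, L. Rey-Bellet, EJP **23** (2018) no. 55, Prop. 3.6 (proof);
  J. C. Mattingly, É. Pardoux, CPAM **59** (2006), §§3–4 (finite-dimensional controls). [folklore]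
-/

noncomputable section

open MeasureTheory ProbabilityTheory Filter Topology Set Metric Function unitInterval
open scoped NNReal ENNReal

namespace Literature.MathematicalPhysics.KineticTheory

open Literature.Probability.Process Literature.Analysis.ODE Literature.Analysis.Calculus

variable {E : Type*} [NormedAddCommGroup E] [NormedSpace ℝ E]

/-! ### The amplitudes are a rescaling of the skeleton -/

/-- **Rescaling the skeleton rescales the noise vectors**: the noise path of the skeleton
`(l₁ x¹, l₂ x²)` along `(v₁, v₂)` is the noise path of `x` along `(l₁ v₁, l₂ v₂)`. [folklore] -/
theorem skelNoisePath_smul {F : Submodule ℝ E} (m : ℕ) (v₁ v₂ : E) (l₁ l₂ : ℝ) (x : PairSkeleton m)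
    (ρ : C(I, F)) :
    skelNoisePath m v₁ v₂ (l₁ • x.1, l₂ • x.2) ρ = skelNoisePath m (l₁ • v₁) (l₂ • v₂) x ρ := by
  funext t
  simp only [skelNoisePath_apply, plInterp_smul, smul_smul, mul_comm]

namespace ConfinedDrift

/-! ### The minorisation at time one, uniformly in the amplitude ratios -/

section One

variable [FiniteDimensional ℝ E] [CompleteSpace E] [MeasurableSpace E] [BorelSpace E]
  [SecondCountableTopology E] {Y : E → E} (D : ConfinedDrift Y) (hY : ContDiff ℝ 1 Y)
  {x₀ : E} (hx₀ : Y x₀ = 0) {v₁ v₂ : E} (hv₁ : v₁ ∈ D.noise) (hv₂ : v₂ ∈ D.noise)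
  (hKal : ∀ ℓ : E →ₗ[ℝ] ℝ, (∀ k : ℕ, ℓ (((fderiv ℝ Y x₀) ^ k) v₁) = 0) → ℓ = 0)
  (Λ : Measure E) [Λ.IsAddHaarMeasure]
include D hY hx₀ hv₁ hv₂ hKal

set_option maxHeartbeats 1600000 in
/-- **Local minorisation at time one near a controllable equilibrium, uniformly in the noise
amplitudes** (Hörmander-free): if `Y x₀ = 0` and `(DY(x₀), v₁)` satisfies Kalman's condition,
there are `ε₁, r > 0` and `c > 0` such that `P^{l₁v₁, l₂v₂}_1(z, T) ≥ c · Λ(T)` for every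
measurable `T ⊆ B(x₀, r)`, every initial condition `z ∈ B(x₀, ε₁)` and all amplitude ratios with
`|l₁ - 1| < ε₁`, `|l₂ - 1| < ε₁`. Proof: the one of `minorization_at_one`, with the skeleton objects
built at the reference vectors and the skeleton rescaled by `diag(l₁, l₂)`; the ratios join `(z, ρ)`
in the parameter of the uniform submersion estimate.
[cite: CuneoEckmannHairerReyBellet2018, Prop 3.6 (proof)] -/
theorem minorization_at_one_uniform :
    ∃ ε₁ : ℝ, 0 < ε₁ ∧ ∃ r : ℝ, 0 < r ∧ ∃ c : ℝ≥0∞, 0 < c ∧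
      ∀ l₁ l₂ : ℝ, |l₁ - 1| < ε₁ → |l₂ - 1| < ε₁ →
        ∀ z ∈ ball x₀ ε₁, ∀ T ⊆ ball x₀ r, MeasurableSet T →
          c * Λ T ≤ sdeKernel Y (l₁ • v₁) (l₂ • v₂) 1 z T := by
  classical
  -- the level `m` and the skeleton objects AT THE REFERENCE VECTORS
  obtain ⟨m, hm⟩ := D.exists_skeleton_level_surjective hY hx₀ hv₁ hv₂ hKal
  obtain ⟨g, hg⟩ := exists_skelForcingCLM (F := D.noise) m v₁ v₂
  obtain ⟨S, hSapply, hS, huniq, hdiff⟩ := D.exists_skelSol m hv₁ hv₂ g hg le_rfl hY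
  have hS0 : S (x₀, 0, 0) = ContinuousMap.const I x₀ := D.skelSol_equilibrium m hSapply hx₀
  have hsurjT := hm g hg S hS huniq
  -- the rescaling of the skeleton
  let Sc : ℝ × ℝ → PairSkeleton m →L[ℝ] PairSkeleton m := fun l =>
    (l.1 • ContinuousLinearMap.id ℝ (Fin (2 ^ m) → ℝ)).prodMap (l.2 • ContinuousLinearMap.id ℝ (Fin (2 ^ m) → ℝ))
  have hScapply : ∀ (l : ℝ × ℝ) (x : PairSkeleton m), Sc l x = (l.1 • x.1, l.2 • x.2) := fun l x => rfl
  have hSc1 : Sc (1, 1) = ContinuousLinearMap.id ℝ (PairSkeleton m) := by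
    ext x <;> simp [hScapply]
  have hSc0 : ∀ l : ℝ × ℝ, Sc l 0 = 0 := fun l => map_zero _
  have hScc : Continuous fun l : ℝ × ℝ => Sc l :=
    (continuous_fst.smul continuous_const).prod_mapL ℝ (continuous_snd.smul continuous_const)
  -- the parameter space: `((z, ρ), (l₁, l₂))`
  let ι : PairSkeleton m →L[ℝ] E × PairSkeleton m × C(I, D.noise) :=
    (ContinuousLinearMap.inr ℝ E (PairSkeleton m × C(I, D.noise))).comp
      (ContinuousLinearMap.inl ℝ (PairSkeleton m) C(I, D.noise))
  have hι : ∀ x : PairSkeleton m, ι x = ((0 : E), x, (0 : C(I, D.noise))) := fun x => rfl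
  let f : (E × C(I, D.noise)) × (ℝ × ℝ) → PairSkeleton m → E :=
    fun p x => S (p.1.1, Sc p.2 x, p.1.2) 1
  let f' : (E × C(I, D.noise)) × (ℝ × ℝ) → PairSkeleton m → PairSkeleton m →L[ℝ] E :=
    fun p x => (ContinuousMap.evalCLM ℝ (1 : I)).comp (((fderiv ℝ S (p.1.1, Sc p.2 x, p.1.2)).comp ι).comp (Sc p.2))
  have hSd : Differentiable ℝ S := hdiff.differentiable one_ne_zero
  have hf' : ∀ p x, HasFDerivAt (f p) (f' p x) x := by
    intro p x
    have hA : HasFDerivAt (fun x : PairSkeleton m => (p.1.1, Sc p.2 x, p.1.2)) (ι.comp (Sc p.2)) x := by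
      have h1 : (fun x : PairSkeleton m => (p.1.1, Sc p.2 x, p.1.2)) =
          fun x => (ι.comp (Sc p.2)) x + (p.1.1, 0, p.1.2) := by
        funext x; rw [ContinuousLinearMap.comp_apply, hι]; simp
      rw [h1]
      exact (ι.comp (Sc p.2)).hasFDerivAt.add_const _
    have hSx := (hSd (p.1.1, Sc p.2 x, p.1.2)).hasFDerivAt.comp x hA
    have h := (ContinuousMap.evalCLM ℝ (1 : I)).hasFDerivAt.comp x hSx
    have e : (ContinuousMap.evalCLM ℝ (1 : I)).comp ((fderiv ℝ S (p.1.1, Sc p.2 x, p.1.2)).comp (ι.comp (Sc p.2))) =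
        f' p x := by
      simp only [f', ContinuousLinearMap.comp_assoc]
    rw [e] at h
    exact h
  have hcontf' : Continuous fun q : ((E × C(I, D.noise)) × (ℝ × ℝ)) × PairSkeleton m => f' q.1 q.2 := by
    have hScx : Continuous fun q : ((E × C(I, D.noise)) × (ℝ × ℝ)) × PairSkeleton m => Sc q.1.2 q.2 := by
      simp only [hScapply]; fun_prop
    have h1 : Continuous fun q : ((E × C(I, D.noise)) × (ℝ × ℝ)) × PairSkeleton m =>
        fderiv ℝ S (q.1.1.1, Sc q.1.2 q.2, q.1.1.2) :=
      (hdiff.continuous_fderiv one_ne_zero).comp (by fun_prop)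
    have h2 : Continuous fun q : ((E × C(I, D.noise)) × (ℝ × ℝ)) × PairSkeleton m => Sc q.1.2 :=
      hScc.comp (continuous_snd.comp continuous_fst)
    exact continuous_const.clm_comp ((h1.clm_comp continuous_const).clm_comp h2)
  have hcontf : Continuous fun p : (E × C(I, D.noise)) × (ℝ × ℝ) => f p 0 := by
    have h0 : (fun p : (E × C(I, D.noise)) × (ℝ × ℝ) => f p 0) = fun p => S (p.1.1, 0, p.1.2) 1 := by
      funext p; simp only [f, hSc0]
    rw [h0]
    exact (ContinuousMap.evalCLM ℝ (1 : I)).continuous.comp (hdiff.continuous.comp (by fun_prop))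
  set p₀ : (E × C(I, D.noise)) × (ℝ × ℝ) := ((x₀, 0), (1, 1)) with hp₀
  have hf00 : f p₀ 0 = x₀ := by
    show S (x₀, Sc (1, 1) (0 : PairSkeleton m), (0 : C(I, D.noise))) 1 = x₀
    rw [hSc0, hS0]
    rfl
  have hsurj : LinearMap.range (f' p₀ 0 : PairSkeleton m →ₗ[ℝ] E) = ⊤ := by
    show LinearMap.range (((ContinuousMap.evalCLM ℝ (1 : I)).comp (((fderiv ℝ S (x₀,
      Sc (1, 1) (0 : PairSkeleton m), (0 : C(I, D.noise)))).comp ι).comp (Sc (1, 1)))) :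
        PairSkeleton m →ₗ[ℝ] E) = ⊤
    rw [hSc0, hSc1, ContinuousLinearMap.comp_id]
    exact hsurjT
  -- nontriviality of the skeleton space
  haveI : Nontrivial (PairSkeleton m) := by
    refine ⟨⟨0, (fun _ => 1, 0), fun h => ?_⟩⟩
    have := congrArg (fun q : PairSkeleton m => q.1 ⟨0, Nat.two_pow_pos m⟩) h
    simp at this
  -- Haar instances on the skeleton space
  haveI hpiS : (volume : Measure (Fin (2 ^ m) → ℝ)).IsAddHaarMeasure := isAddHaarMeasure_volume_pi _
  haveI hvolS : (volume : Measure (PairSkeleton m)).IsAddHaarMeasure :=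
    Measure.prod.instIsAddHaarMeasure (volume : Measure (Fin (2 ^ m) → ℝ))
      (volume : Measure (Fin (2 ^ m) → ℝ))
  -- the submersion estimate, uniformly in `((z, ρ), (l₁, l₂))` near `((x₀, 0), (1, 1))`
  obtain ⟨V, hV, ρ₀, hρ₀, r, hr, c, hc, hmin⟩ :=
    exists_measure_preimage_ge_of_surjective (volume : Measure (PairSkeleton m)) Λ f f'
      (Eventually.of_forall fun q => hf' q.1 q.2) hcontf'.continuousAt hcontf.continuousAt hsurj
  rw [hf00] at hmin
  obtain ⟨ε₀, hε₀, hε₀V⟩ := Metric.mem_nhds_iff.1 hV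
  set ε₁ : ℝ := min ε₀ 1 with hε₁
  have hε₁pos : 0 < ε₁ := lt_min hε₀ one_pos
  have hε₁0 : ε₁ ≤ ε₀ := min_le_left _ _
  have hε₁1 : ε₁ ≤ 1 := min_le_right _ _
  -- the law of the skeleton dominates Lebesgue measure on the ball of radius `ρ₀`
  obtain ⟨c₂, hc₂, hskel⟩ := exists_wienerPair_map_pairSkel_ge m ρ₀
  -- the good remainders (amplitudes at most twice the reference ones)
  set cmax : ℝ := 2 * (‖v₁‖ + ‖v₂‖) with hcmax
  have hcmax0 : 0 ≤ cmax := by positivity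
  have hCpos : 0 < (cmax + 1) * (1 + 2 * 2 ^ m) := by positivity
  set ε' : ℝ := ε₁ / 2 / ((cmax + 1) * (1 + 2 * 2 ^ m)) with hε'
  have hε'pos : 0 < ε' := by positivity
  have hε'bound : cmax * ((1 + 2 * 2 ^ m) * ε') < ε₁ := by
    have h1 : cmax * ((1 + 2 * 2 ^ m) * ε') ≤ (cmax + 1) * ((1 + 2 * 2 ^ m) * ε') :=
      mul_le_mul_of_nonneg_right (by linarith) (by positivity)
    have h2 : (cmax + 1) * ((1 + 2 * 2 ^ m) * ε') = ε₁ / 2 := by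
      rw [hε']; field_simp
    linarith
  -- the set of good remainder pairs (countably many conditions: measurable)
  set GoodR : Set WienerPair := {rr | (∀ n k : ℕ, ((k : ℝ≥0) / 2 ^ n ≤ 1) →
      |rr.1 ((k : ℝ≥0) / 2 ^ n)| ≤ (1 + 2 * 2 ^ m) * ε' ∧ |rr.2 ((k : ℝ≥0) / 2 ^ n)| ≤ (1 + 2 * 2 ^ m) * ε')}
    with hGoodR
  have hGoodRm : MeasurableSet GoodR := by
    have : GoodR = ⋂ n : ℕ, ⋂ k : ℕ, {rr : WienerPair | ((k : ℝ≥0) / 2 ^ n ≤ 1) →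
        |rr.1 ((k : ℝ≥0) / 2 ^ n)| ≤ (1 + 2 * 2 ^ m) * ε' ∧
          |rr.2 ((k : ℝ≥0) / 2 ^ n)| ≤ (1 + 2 * 2 ^ m) * ε'} := by
      ext rr; simp [hGoodR]
    rw [this]
    refine MeasurableSet.iInter fun n => MeasurableSet.iInter fun k => ?_
    by_cases hkn : (k : ℝ≥0) / 2 ^ n ≤ 1
    · simp only [hkn, forall_const]
      exact (measurableSet_le ((measurable_pi_apply _).comp measurable_fst).abs measurable_const).inter
        (measurableSet_le ((measurable_pi_apply _).comp measurable_snd).abs measurable_const)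
    · simp [hkn]
  have hgood_sub : goodEvent ε' 1 ⊆ (pairRem m) ⁻¹' GoodR := by
    intro w hw n k hk
    exact abs_pairRem_le_of_mem_goodEvent m hw hk
  have hgood_pos : 0 < wienerPair (goodEvent ε' 1) := wienerPair_goodEvent_pos hε'pos 1
  -- the constants
  refine ⟨ε₁, hε₁pos, r, hr, c₂ * c * wienerPair (goodEvent ε' 1),
    ENNReal.mul_pos (ENNReal.mul_pos hc₂.ne' hc.ne').ne' hgood_pos.ne',
    fun l₁ l₂ hl₁ hl₂ z hz T hT hTm => ?_⟩
  -- the actual noise vectors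
  set a₁ : E := l₁ • v₁ with ha₁
  set a₂ : E := l₂ • v₂ with ha₂
  have ha₁m : a₁ ∈ D.noise := D.noise.smul_mem _ hv₁
  have ha₂m : a₂ ∈ D.noise := D.noise.smul_mem _ hv₂
  have hl₁2 : |l₁| ≤ 2 := by
    have h := abs_sub_abs_le_abs_sub l₁ 1
    rw [abs_one] at h
    linarith [hl₁, hε₁1]
  have hl₂2 : |l₂| ≤ 2 := by
    have h := abs_sub_abs_le_abs_sub l₂ 1
    rw [abs_one] at h
    linarith [hl₂, hε₁1]
  have hnorm₁ : ‖a₁‖ ≤ 2 * ‖v₁‖ := by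
    rw [ha₁, norm_smul, Real.norm_eq_abs]; nlinarith [norm_nonneg v₁]
  have hnorm₂ : ‖a₂‖ ≤ 2 * ‖v₂‖ := by
    rw [ha₂, norm_smul, Real.norm_eq_abs]; nlinarith [norm_nonneg v₂]
  have hnorm : ‖a₁‖ + ‖a₂‖ ≤ cmax := by rw [hcmax]; linarith
  -- the solution family at the actual vectors, expressed through the reference one
  let Sa : E × PairSkeleton m × C(I, D.noise) → C(I, E) := fun p => S (p.1, Sc (l₁, l₂) p.2.1, p.2.2)
  have hSa : ∀ p τ, Sa p τ = drivenFlow Y p.1 (skelNoisePath m a₁ a₂ p.2.1 p.2.2) τ := by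
    intro p τ
    show S (p.1, Sc (l₁, l₂) p.2.1, p.2.2) τ = _
    rw [hSapply, hScapply, skelNoisePath_smul]
  -- the transition probability as a Wiener integral, factorised through the skeleton
  have hkernel : sdeKernel Y a₁ a₂ 1 z T =
      wienerPair ((fun w => sdeSolMap Y a₁ a₂ 1 z (pairPath w)) ⁻¹' T) := by
    have h := D.sdeKernel_apply' ha₁m ha₂m 1 z hTm
    simpa using h
  -- the integrand `G(x, rr) = 1_T(Φ_1(z, PL x + rr)) 1_{GoodR}(rr)`
  have h1m := D.measurable_sdeSolMap ha₁m ha₂m (1 : ℝ)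
  have h2m : Measurable fun q : PairSkeleton m × WienerPair => ((z : E), pairRecon m q.1 q.2) :=
    measurable_const.prodMk (measurable_pairRecon m)
  have hsolm : Measurable ((fun p : E × WienerPair => sdeSolMap Y a₁ a₂ 1 p.1 p.2) ∘
      (fun q : PairSkeleton m × WienerPair => ((z : E), pairRecon m q.1 q.2))) :=
    Measurable.comp h1m h2m
  let G : PairSkeleton m × WienerPair → ℝ≥0∞ := fun q =>
    ((T.indicator (1 : E → ℝ≥0∞)) ∘ ((fun p : E × WienerPair => sdeSolMap Y a₁ a₂ 1 p.1 p.2) ∘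
      (fun q : PairSkeleton m × WienerPair => ((z : E), pairRecon m q.1 q.2)))) q *
      GoodR.indicator 1 q.2
  have hGm : Measurable G :=
    ((measurable_one.indicator hTm).comp hsolm).mul ((measurable_one.indicator hGoodRm).comp measurable_snd)
  -- `G(Ξ ω, R ω) ≤ 1_{Φ_1(z, B ω) ∈ T}`
  have hGle : ∀ w, G (pairSkel m w, pairRem m w) ≤
      ((fun w => sdeSolMap Y a₁ a₂ 1 z (pairPath w)) ⁻¹' T).indicator 1 w := by
    intro w
    simp only [G, Function.comp_apply]
    rw [pairRecon_pairSkel_pairRem]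
    by_cases hmem : sdeSolMap Y a₁ a₂ 1 z (pairPath w) ∈ T
    · rw [indicator_of_mem hmem, indicator_of_mem
        (show w ∈ (fun w => sdeSolMap Y a₁ a₂ 1 z (pairPath w)) ⁻¹' T from hmem)]
      simp only [Pi.one_apply, one_mul]
      exact indicator_le_self' (fun _ _ => zero_le_one) _
    · rw [indicator_of_notMem hmem, zero_mul]
      exact zero_le
  -- for a good remainder of the Brownian pair, the inner integral is at least `c₂ c Λ(T)`
  have hinner : ∀ w, pairRem m w ∈ GoodR →
      c₂ * c * Λ T ≤ ∫⁻ x, G (x, pairRem m w) ∂(wienerPair.map (pairSkel m)) := by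
    intro w hwR
    set rr := pairRem m w with hrr
    have hr1 : Continuous rr.1 := continuous_pairRem_fst m w
    have hr2 : Continuous rr.2 := continuous_pairRem_snd m w
    have hpl0 : ∀ y : Fin (2 ^ m) → ℝ, plInterp m y 0 = 0 := fun y => by simp [plInterp, tentCoeff]
    have hr10 : rr.1 0 = 0 := by simp [hrr, pairRem, bridgeRem, hpl0, pairPath]
    have hr20 : rr.2 0 = 0 := by simp [hrr, pairRem, bridgeRem, hpl0, pairPath]
    -- the remainder noise path (at the actual vectors) and its smallness
    let ρr : C(I, D.noise) := remNoisePath m ha₁m ha₂m w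
    have hρr : ∀ τ : I, (ρr τ : E) = rr.1 ⟨(τ : ℝ), τ.2.1⟩ • a₁ + rr.2 ⟨(τ : ℝ), τ.2.1⟩ • a₂ :=
      fun τ => remNoisePath_apply m ha₁m ha₂m w τ
    have hsmall : ∀ u : ℝ≥0, u ≤ 1 →
        |rr.1 u| ≤ (1 + 2 * 2 ^ m) * ε' ∧ |rr.2 u| ≤ (1 + 2 * 2 ^ m) * ε' := by
      intro u hu
      exact ⟨abs_le_of_dyadic hr1 (fun n k hk => (hwR n k hk).1) hu,
        abs_le_of_dyadic hr2 (fun n k hk => (hwR n k hk).2) hu⟩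
    have hρnorm : ‖ρr‖ < ε₁ := by
      refine (ContinuousMap.norm_lt_iff _ hε₁pos).2 fun τ => ?_
      rw [Submodule.coe_norm, hρr]
      obtain ⟨h1, h2⟩ := hsmall ⟨(τ : ℝ), τ.2.1⟩ (by exact_mod_cast τ.2.2)
      have hL' : ‖rr.1 ⟨(τ : ℝ), τ.2.1⟩ • a₁‖ ≤ ‖a₁‖ * ((1 + 2 * 2 ^ m) * ε') := by
        rw [norm_smul, Real.norm_eq_abs, mul_comm]
        exact mul_le_mul_of_nonneg_left h1 (norm_nonneg _)
      have hR' : ‖rr.2 ⟨(τ : ℝ), τ.2.1⟩ • a₂‖ ≤ ‖a₂‖ * ((1 + 2 * 2 ^ m) * ε') := by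
        rw [norm_smul, Real.norm_eq_abs, mul_comm]
        exact mul_le_mul_of_nonneg_left h2 (norm_nonneg _)
      calc _ ≤ ‖rr.1 ⟨(τ : ℝ), τ.2.1⟩ • a₁‖ + ‖rr.2 ⟨(τ : ℝ), τ.2.1⟩ • a₂‖ := norm_add_le _ _
        _ ≤ ‖a₁‖ * ((1 + 2 * 2 ^ m) * ε') + ‖a₂‖ * ((1 + 2 * 2 ^ m) * ε') := add_le_add hL' hR'
        _ = (‖a₁‖ + ‖a₂‖) * ((1 + 2 * 2 ^ m) * ε') := by ring
        _ ≤ cmax * ((1 + 2 * 2 ^ m) * ε') := mul_le_mul_of_nonneg_right hnorm (by positivity)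
        _ < ε₁ := hε'bound
    -- `((z, ρr), (l₁, l₂)) ∈ V`
    have hzρ : (((z, ρr), (l₁, l₂)) : (E × C(I, D.noise)) × (ℝ × ℝ)) ∈ V := by
      refine hε₀V ?_
      rw [mem_ball]
      change max (max (dist z x₀) (dist ρr 0)) (max (dist l₁ 1) (dist l₂ 1)) < ε₀
      rw [dist_zero_right, Real.dist_eq, Real.dist_eq]
      exact max_lt (max_lt ((mem_ball.1 hz).trans_le hε₁0) (hρnorm.trans_le hε₁0))
        (max_lt (hl₁.trans_le hε₁0) (hl₂.trans_le hε₁0))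
    -- the inner integrand is the indicator of `{x | f ((z, ρr), (l₁, l₂)) x ∈ T}`
    have hGeq : ∀ x, G (x, rr) = ((f ((z, ρr), (l₁, l₂))) ⁻¹' T).indicator 1 x := by
      intro x
      simp only [G, Function.comp_apply]
      rw [indicator_of_mem hwR, Pi.one_apply, mul_one,
        D.sdeSolMap_one_pairRecon_eq_skelSol m ha₁m ha₂m (S := Sa) hSa x hr1 hr2 hr10 hr20 ρr hρr z]
      rfl
    simp_rw [hGeq]
    have hfTm : MeasurableSet ((f ((z, ρr), (l₁, l₂))) ⁻¹' T) :=
      ((hf' ((z, ρr), (l₁, l₂)) ·) |> fun h =>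
        (continuous_iff_continuousAt.2 fun x => (h x).continuousAt)).measurable hTm
    rw [lintegral_indicator_one hfTm]
    calc c₂ * c * Λ T = c₂ * (c * Λ T) := mul_assoc _ _ _
      _ ≤ c₂ * volume (closedBall (0 : PairSkeleton m) ρ₀ ∩ f ((z, ρr), (l₁, l₂)) ⁻¹' T) :=
          mul_le_mul' le_rfl (hmin _ hzρ T hT hTm)
      _ ≤ wienerPair.map (pairSkel m) (closedBall (0 : PairSkeleton m) ρ₀ ∩ f ((z, ρr), (l₁, l₂)) ⁻¹' T) :=
          hskel _ inter_subset_left (measurableSet_closedBall.inter hfTm)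
      _ ≤ wienerPair.map (pairSkel m) (f ((z, ρr), (l₁, l₂)) ⁻¹' T) := measure_mono inter_subset_right
  -- assemble: Wiener integral ≥ factorised integral ≥ good part
  rw [hkernel, ← lintegral_indicator_one ((hTm.preimage
    (D.measurable_sdeSolMap_pairPath_right ha₁m ha₂m 1 z)))]
  calc c₂ * c * wienerPair (goodEvent ε' 1) * Λ T
      = c₂ * c * Λ T * wienerPair (goodEvent ε' 1) := by ring
    _ ≤ c₂ * c * Λ T * wienerPair ((pairRem m) ⁻¹' GoodR) := by
        gcongr
    _ = ∫⁻ w, ((pairRem m) ⁻¹' GoodR).indicator (fun _ => c₂ * c * Λ T) w ∂wienerPair := by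
        rw [lintegral_indicator_const (hGoodRm.preimage (measurable_pairRem m))]
    _ ≤ ∫⁻ w, ∫⁻ x, G (x, pairRem m w) ∂(wienerPair.map (pairSkel m)) ∂wienerPair := by
        refine lintegral_mono fun w => ?_
        by_cases hwR : pairRem m w ∈ GoodR
        · rw [indicator_of_mem (show w ∈ (pairRem m) ⁻¹' GoodR from hwR)]
          exact hinner w hwR
        · rw [indicator_of_notMem (show w ∉ (pairRem m) ⁻¹' GoodR from hwR)]
          exact zero_le
    _ = ∫⁻ w, G (pairSkel m w, pairRem m w) ∂wienerPair := (lintegral_pairSkel_pairRem m hGm).symm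
    _ ≤ ∫⁻ w, ((fun w => sdeSolMap Y a₁ a₂ 1 z (pairPath w)) ⁻¹' T).indicator 1 w ∂wienerPair :=
        lintegral_mono hGle

/-- **The uniform minorisation at time one in measure form**: `P^{l₁v₁, l₂v₂}_1(z, ·) ≥ c Λ|_{B(x₀, r)}`
for all `z ∈ B(x₀, ε₁)` and all `|l₁ - 1|, |l₂ - 1| < ε₁`. [cite: CuneoEckmannHairerReyBellet2018, Prop 3.6 (proof)] -/
theorem exists_smul_restrict_le_sdeKernel_one_uniform :
    ∃ ε₁ : ℝ, 0 < ε₁ ∧ ∃ r : ℝ, 0 < r ∧ ∃ c : ℝ≥0∞, 0 < c ∧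
      ∀ l₁ l₂ : ℝ, |l₁ - 1| < ε₁ → |l₂ - 1| < ε₁ →
        ∀ z ∈ ball x₀ ε₁, c • Λ.restrict (ball x₀ r) ≤ sdeKernel Y (l₁ • v₁) (l₂ • v₂) 1 z := by
  obtain ⟨ε₁, hε₁, r, hr, c, hc, h⟩ := D.minorization_at_one_uniform hY hx₀ hv₁ hv₂ hKal Λ
  refine ⟨ε₁, hε₁, r, hr, c, hc, fun l₁ l₂ hl₁ hl₂ z hz => Measure.le_iff.2 fun T hTm => ?_⟩
  rw [Measure.smul_apply, Measure.restrict_apply hTm, smul_eq_mul]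
  exact (h l₁ l₂ hl₁ hl₂ z hz (T ∩ ball x₀ r) inter_subset_right (hTm.inter measurableSet_ball)).trans
    (measure_mono inter_subset_left)

end One

end ConfinedDrift

end Literature.MathematicalPhysics.KineticTheory

end
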